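import Literature.Probability.RandomPlanarGeometry.SAWCountZdCoefficientPolynomiality
import Literature.Probability.RandomPlanarGeometry.SAWCountZdSymbolLeadingCoefficient
import HarnessLib

/-!
# FIRST CANCELLATION: the Stirling polynomials with their leading term, and the bad-word correction to the `j`-th `1/d`-symbol of `c_n(ℤ^d)` has degree at most `2j − 4`

Topic `Literature/Probability/RandomPlanarGeometry` (the «SYMBOL POLYNOMIALITY» programme of the lane: ζ `SAWCountZdCoefficientPolynomiality.lean`
(`countPoly`, `exists_polynomial_countPoly_coeff`, the existential Stirling polynomials `exists_poly_descPochhammer_coeff_sub`), β `SAWCountZdSymbolPolynomiality.lean`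
(`symbolPoly`, `card_badSlice_eq_pow_mul_eval`), η `SAWCountZdSymbolDegree.lean`, λ `SAWCountZdSymbolLeadingCoefficient.lean` (`coeff_symbolPoly_two_mul_sub_three :
coeff_{X^{2j−3}} R_j = 2^{−j}/(j−2)!`, `natDegree_symbolPoly : = 2j − 3`); Mathlib's Faulhaber formula `sum_range_pow` and `descPochhammer`).

PRINTED CONTEXT (locators only; nothing is quoted digit-for-digit). Stanley, EC1 (2nd ed.) §1.3: Lemma 1.3.6 (the recurrence `c(n,k) = (n−1)c(n−1,k) +
c(n−1,k−1)`), Proposition 1.3.7 eq. (1.28) (`Σ_k c(n,k) t^k = t(t+1)⋯(t+n−1)`, so `[X^k] X(X−1)⋯(X−n+1) = s(n,k)`), Exercise 1.43 (`c(n,n−1)`, `c(n,n−2)`). That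
`s(m, m−k)` is a polynomial in `m` of degree `2k` with leading coefficient `(−1)^k/(2^k k!)` is classical (Stirling polynomials); we prove it here from the
recurrence and Faulhaber, citing Stanley for the objects. Madras–Slade (1993) §1.1 eq. (1.1.8) p. 5 (the `1/d` expansion of `μ`), Definition 1.2.4, §1.2 p. 10
(memory-2 walks `2d(2d−1)^{n−1}`); Clisby–Liang–Slade (2007) §3.3 eqs. (29)/(31). NOT IN PRINT as far as the lane's desks could locate: the SAW statements below.

THE THEOREM. ζ proved: for every `j ≥ 2` there is `S_j ∈ ℚ[X]` with `[X^{n−j}] P_n = 2^n S_j(n)` for all `n ≥ 2j − 1` (`P_n = countPoly n`, `c_n(ℤ^d) = P_n(d)`),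
`S_j = A_j − B_j`, `A_j = (−1)^j/(2^j j!)·(X−1)⋯(X−j)` (the memory-2 part), `B_j = Σ_{i=2}^{j} R_i(X)·E_{j−i}(X − i)` (the bad-word correction; `R_i = symbolPoly i`,
`E_k` the Stirling polynomials). HERE: (1) the Stirling polynomials made EXPLICIT — `stirlingPoly k` with ★ `descPochhammer_coeff_sub_eq_eval_stirlingPoly`
(`[X^{m−k}] (X)_m = E_k(m)`, `m ≥ k`), ★ `natDegree_stirlingPoly : deg E_k = 2k`, ★ `leadingCoeff_stirlingPoly : lc E_k = (−1)^k/(2^k·k!)` (via the summation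
operator `sumPoly` on `ℚ[X]` and its top coefficient `lc(q)/(deg q + 1)`); (2) the coefficient polynomial made EXPLICIT — `coeffPoly j = symbolMainPoly j − symbolCorrPoly j`
with ★★ `countPoly_coeff_eq_pow_mul_eval_coeffPoly` and uniqueness `eq_coeffPoly_of_forall`; (3) ★★★ FIRST CANCELLATION `coeff_symbolCorrPoly_two_mul_sub_three_eq_zero`:
each of the `j − 1` summands of `B_j` has degree EXACTLY `2j − 3` (λ + (1)), and their top coefficients `2^{−i}/(i−2)!·(−1)^{j−i}/(2^{j−i}(j−i)!)` sum to
`2^{−j}/(j−2)!·(1−1)^{j−2} = 0` for `j ≥ 3` — so ★★★ `natDegree_symbolCorrPoly_le_sub_four : deg B_j ≤ 2j − 4` (`j ≥ 3`), ★★ `natDegree_coeffPoly_le :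
deg S_j ≤ max(j, 2j − 4)` (`j ≥ 2`), ★★ `natDegree_coeffPoly_of_le_three` (for `j = 2, 3`: `deg S_j = j`, `lc S_j = (−1)^j/(2^j j!)` — the monic face of the
tree's `n² − 5n + 8` / `−(n³ − 12n² + 59n − 138)` laws), ★★★ `exists_polynomial_countPoly_coeff_natDegree_le` (ζ sharpened by one degree for every `j ≥ 4`).
This is the first of the `j − 3` cancellations predicted by the lane's STRUCTURE CONJECTURE «`deg_n [d^{n−j}] c_n = j`, leading term `(−1)^j n^j 2^{n−j}/j!`»
(FINDING-ZD-FOURTH-SYMBOL §8; equivalently `deg B_j ≤ j − 1`), which is a theorem for `j ≤ 6` by the kernel censuses and OPEN in general.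
Tool notions (the lane's): `faulhaberPoly`, `sumPoly`, `stirlingPoly`, `symbolMainPoly`, `symbolCorrPoly`, `coeffPoly`.

THIS FILE (lane «pcv-sawmu», a-p1 g26; all PROVED, standard axioms): `faulhaberPoly`, `faulhaberPoly_eval`, `natDegree_faulhaberPoly_le`, `coeff_faulhaberPoly_succ`,
`sumPoly`, `sumPoly_eval`, `natDegree_sumPoly_le`, `coeff_sumPoly_natDegree_succ`, `stirlingPoly`, `stirlingPoly_zero`, `stirlingPoly_succ`, `stirlingPoly_succ_eval`,
★ `descPochhammer_coeff_sub_eq_eval_stirlingPoly`, ★ `natDegree_stirlingPoly_le_and_coeff`, `natDegree_stirlingPoly`, `leadingCoeff_stirlingPoly`, `stirlingPoly_ne_zero`,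
`eq_stirlingPoly_of_eval`, `stirlingPoly_one`, `symbolMainPoly`, `symbolCorrPoly`, `coeffPoly`, ★★ `countPoly_coeff_eq_pow_mul_eval_coeffPoly`, `eq_coeffPoly_of_forall`,
`natDegree_symbolMainPoly`, `leadingCoeff_symbolMainPoly`, `natDegree_symbolCorrPoly_term`, `coeff_symbolCorrPoly_term`, `natDegree_symbolCorrPoly_le`,
`coeff_symbolCorrPoly_top_eq_sum`, ★★★ `coeff_symbolCorrPoly_two_mul_sub_three_eq_zero`, `coeff_symbolCorrPoly_two`, ★★★ `natDegree_symbolCorrPoly_le_sub_four`,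
★★ `natDegree_coeffPoly_le`, `coeff_coeffPoly_two_mul_sub_three_eq_zero`, ★★ `natDegree_coeffPoly_of_le_three`, ★★★ `exists_polynomial_countPoly_coeff_natDegree_le`.
[cite: Stanley2012EC1, §1.3 Lemma 1.3.6; Prop. 1.3.7 eq. (1.28); Exercise 1.43] [cite: MadrasSlade1993, §1.1 eq. (1.1.8) p. 5; Definition 1.2.4; §1.2 (p. 10)]
[cite: ClisbyLiangSlade2007, §3.3 eqs. (29)/(31)]

Provenance: lane «pcv-sawmu», a-p1 g26 (2026-08-28).
-/

noncomputable section

open Finset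
open scoped BigOperators
open Literature.Probability.LatticeModels
open Literature.Probability.RandomPlanarGeometry.SAW
open Literature.Probability.Percolation

namespace Literature.Probability.RandomPlanarGeometry.SAW.Zd

namespace WordTypes

/-! ### Faulhaber polynomials and the summation operator on `ℚ[X]` -/

/-- The FAULHABER POLYNOMIAL `F_p(X) = Σ_{i ≤ p} B_i C(p+1, i)/(p+1) · X^{p+1−i}` with `Σ_{k<m} k^p = F_p(m)` (Mathlib's `sum_range_pow`
made a polynomial). [cite: Stanley2012EC1, §1.3 Prop. 1.3.7 eq. (1.28); lane plumbing] -/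
def faulhaberPoly (p : ℕ) : Polynomial ℚ :=
  ∑ i ∈ Finset.range (p + 1), Polynomial.C (_root_.bernoulli i * ((p + 1).choose i : ℚ) / ((p : ℚ) + 1)) * Polynomial.X ^ (p + 1 - i)

/-- `F_p(m) = Σ_{k<m} k^p`. [cite: Stanley2012EC1, §1.3 Prop. 1.3.7 eq. (1.28); lane plumbing] -/
theorem faulhaberPoly_eval (p m : ℕ) : (faulhaberPoly p).eval (m : ℚ) = ∑ k ∈ Finset.range m, ((k : ℚ) ^ p) := by
  rw [sum_range_pow, faulhaberPoly, Polynomial.eval_finsetSum]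
  refine Finset.sum_congr rfl fun i _ => ?_
  rw [Polynomial.eval_mul, Polynomial.eval_C, Polynomial.eval_pow, Polynomial.eval_X]
  ring

/-- `deg F_p ≤ p + 1`. [cite: Stanley2012EC1, §1.3 Prop. 1.3.7 eq. (1.28); lane plumbing] -/
theorem natDegree_faulhaberPoly_le (p : ℕ) : (faulhaberPoly p).natDegree ≤ p + 1 := by
  unfold faulhaberPoly
  refine Polynomial.natDegree_sum_le_of_forall_le _ _ fun i _ => ?_
  refine (Polynomial.natDegree_C_mul_le _ _).trans ?_
  rw [Polynomial.natDegree_X_pow]; omega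

/-- `[X^{p+1}] F_p = 1/(p+1)`. [cite: Stanley2012EC1, §1.3 Prop. 1.3.7 eq. (1.28); lane plumbing] -/
theorem coeff_faulhaberPoly_succ (p : ℕ) : (faulhaberPoly p).coeff (p + 1) = 1 / ((p : ℚ) + 1) := by
  unfold faulhaberPoly
  rw [Polynomial.finsetSum_coeff, Finset.sum_range_succ', Finset.sum_eq_zero, zero_add, Polynomial.coeff_C_mul,
    Polynomial.coeff_X_pow, if_pos (by omega), _root_.bernoulli_zero, Nat.choose_zero_right]
  · push_cast; ring
  · intro i _
    rw [Polynomial.coeff_C_mul, Polynomial.coeff_X_pow, if_neg (by omega), mul_zero]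

/-- The SUMMATION OPERATOR on `ℚ[X]`: `(sumPoly q)(m) = Σ_{k<m} q(k)`. [cite: Stanley2012EC1, §1.3 Prop. 1.3.7 eq. (1.28); lane tool notion] -/
def sumPoly (q : Polynomial ℚ) : Polynomial ℚ :=
  ∑ p ∈ Finset.range (q.natDegree + 1), Polynomial.C (q.coeff p) * faulhaberPoly p

/-- `(sumPoly q)(m) = Σ_{k<m} q(k)`. [cite: Stanley2012EC1, §1.3 Prop. 1.3.7 eq. (1.28); lane plumbing] -/
theorem sumPoly_eval (q : Polynomial ℚ) (m : ℕ) : (sumPoly q).eval (m : ℚ) = ∑ k ∈ Finset.range m, q.eval (k : ℚ) := by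
  unfold sumPoly
  rw [Polynomial.eval_finsetSum]
  simp_rw [Polynomial.eval_mul, Polynomial.eval_C, faulhaberPoly_eval, Finset.mul_sum]
  rw [Finset.sum_comm]
  refine Finset.sum_congr rfl fun k _ => ?_
  rw [Polynomial.eval_eq_sum_range]

/-- `deg (sumPoly q) ≤ deg q + 1`. [cite: Stanley2012EC1, §1.3 Prop. 1.3.7 eq. (1.28); lane plumbing] -/
theorem natDegree_sumPoly_le (q : Polynomial ℚ) : (sumPoly q).natDegree ≤ q.natDegree + 1 := by
  unfold sumPoly
  refine Polynomial.natDegree_sum_le_of_forall_le _ _ fun p hp => ?_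
  refine (Polynomial.natDegree_C_mul_le _ _).trans ((natDegree_faulhaberPoly_le p).trans ?_)
  have := Finset.mem_range.1 hp; omega

/-- The top coefficient of the sum: `[X^{deg q + 1}] sumPoly q = lc(q)/(deg q + 1)`.
[cite: Stanley2012EC1, §1.3 Prop. 1.3.7 eq. (1.28); lane plumbing] -/
theorem coeff_sumPoly_natDegree_succ (q : Polynomial ℚ) :
    (sumPoly q).coeff (q.natDegree + 1) = q.leadingCoeff / ((q.natDegree : ℚ) + 1) := by
  unfold sumPoly
  rw [Polynomial.finsetSum_coeff, Finset.sum_range_succ, Finset.sum_eq_zero, zero_add, Polynomial.coeff_C_mul,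
    coeff_faulhaberPoly_succ, Polynomial.leadingCoeff]
  · ring
  · intro p hp
    rw [Polynomial.coeff_C_mul, Polynomial.coeff_eq_zero_of_natDegree_lt ((natDegree_faulhaberPoly_le p).trans_lt
      (by have := Finset.mem_range.1 hp; omega)), mul_zero]

/-! ### The Stirling polynomials `E_k`: `[X^{m−k}] X(X−1)⋯(X−m+1) = E_k(m)` (`m ≥ k`), `deg E_k = 2k`, `lc E_k = (−1)^k/(2^k k!)` -/

/-- The STIRLING POLYNOMIALS `E_k ∈ ℚ[X]` (explicit form of `exists_poly_descPochhammer_coeff_sub`): `E₀ = 1`,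
`E_{k+1} = Σ_{i ≤ k} i·E_k(i) − sumPoly (X·E_k)`, so that `E_{k+1}(m) = −Σ_{k < i < m} i·E_k(i)` — the signed Stirling numbers of the first kind
`s(m, m−k)` as polynomials in `m` (`E₁ = −C(X,2)`, `E₂ = C(X,3)(3X−1)/4`, …). [cite: Stanley2012EC1, §1.3 Prop. 1.3.7 eq. (1.28); Exercise 1.43; lane tool notion] -/
def stirlingPoly : ℕ → Polynomial ℚ
  | 0 => 1
  | k + 1 => Polynomial.C (∑ i ∈ Finset.range (k + 1), ((i : ℚ) * (stirlingPoly k).eval (i : ℚ))) - sumPoly (Polynomial.X * stirlingPoly k)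

/-- `E₀ = 1`. [cite: Stanley2012EC1, §1.3 Prop. 1.3.7 eq. (1.28); lane plumbing] -/
@[simp] theorem stirlingPoly_zero : stirlingPoly 0 = 1 := rfl

/-- The recursion. [cite: Stanley2012EC1, §1.3 Prop. 1.3.7 eq. (1.28); lane plumbing] -/
theorem stirlingPoly_succ (k : ℕ) : stirlingPoly (k + 1) =
    Polynomial.C (∑ i ∈ Finset.range (k + 1), ((i : ℚ) * (stirlingPoly k).eval (i : ℚ))) - sumPoly (Polynomial.X * stirlingPoly k) := rfl

/-- `E_{k+1}(m) = −Σ_{i ∈ [k+1, m)} i·E_k(i)` for `m ≥ k + 1`. [cite: Stanley2012EC1, §1.3 Lemma 1.3.6; lane plumbing] -/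
theorem stirlingPoly_succ_eval (k m : ℕ) (hm : k + 1 ≤ m) :
    (stirlingPoly (k + 1)).eval (m : ℚ) = -∑ i ∈ Finset.Ico (k + 1) m, ((i : ℚ) * (stirlingPoly k).eval (i : ℚ)) := by
  rw [stirlingPoly_succ, Polynomial.eval_sub, Polynomial.eval_C, sumPoly_eval]
  simp_rw [Polynomial.eval_mul, Polynomial.eval_X]
  rw [Finset.range_eq_Ico, Finset.range_eq_Ico, ← Finset.sum_Ico_consecutive _ (Nat.zero_le (k + 1)) hm]
  ring

/-- ★ THE STIRLING POLYNOMIALS INTERPOLATE THE FALLING-FACTORIAL COEFFICIENTS: `[X^{m−k}] X(X−1)⋯(X−m+1) = E_k(m)` for every `m ≥ k`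
(from `(X)_{m+1} = (X)_m·(X − m)`: `s(m+1, m−k) = s(m, m−k−1) − m·s(m, m−k)`). [cite: Stanley2012EC1, §1.3 Lemma 1.3.6 & Prop. 1.3.7 eq. (1.28); lane lemma] -/
theorem descPochhammer_coeff_sub_eq_eval_stirlingPoly (k : ℕ) :
    ∀ m : ℕ, k ≤ m → (descPochhammer ℚ m).coeff (m - k) = (stirlingPoly k).eval (m : ℚ) := by
  induction k with
  | zero =>
    intro m _
    rw [Nat.sub_zero, stirlingPoly_zero, Polynomial.eval_one]
    have h := monic_descPochhammer ℚ m
    rw [Polynomial.Monic, Polynomial.leadingCoeff, descPochhammer_natDegree] at h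
    exact h
  | succ k ih =>
    intro m hm
    have hrec : ∀ m : ℕ, k + 1 ≤ m → (descPochhammer ℚ (m + 1)).coeff (m + 1 - (k + 1)) =
        (descPochhammer ℚ m).coeff (m - (k + 1)) - (m : ℚ) * (descPochhammer ℚ m).coeff (m - k) := by
      intro m hm
      rw [descPochhammer_succ_right, mul_sub, Polynomial.coeff_sub, show m + 1 - (k + 1) = (m - (k + 1)) + 1 by omega, Polynomial.coeff_mul_X,
        show ((m : ℕ) : Polynomial ℚ) = Polynomial.C ((m : ℕ) : ℚ) by rw [Polynomial.C_eq_natCast], Polynomial.coeff_mul_C,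
        show m - (k + 1) + 1 = m - k by omega]
      ring
    have hbase : (descPochhammer ℚ (k + 1)).coeff (k + 1 - (k + 1)) = 0 := by
      rw [Nat.sub_self, descPochhammer_succ_left, Polynomial.coeff_X_mul_zero]
    have key : ∀ m : ℕ, k + 1 ≤ m → (descPochhammer ℚ m).coeff (m - (k + 1)) =
        -∑ i ∈ Finset.Ico (k + 1) m, ((i : ℚ) * (stirlingPoly k).eval (i : ℚ)) := by
      intro m hm
      induction m, hm using Nat.le_induction with
      | base => rw [hbase, Finset.Ico_self, Finset.sum_empty, neg_zero]
      | succ m hm ihm =>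
        rw [hrec m hm, ihm, ih m (by omega), Finset.sum_Ico_succ_top hm]
        ring
    rw [key m hm, stirlingPoly_succ_eval k m hm]

/-- ★ DEGREE AND LEADING COEFFICIENT OF THE STIRLING POLYNOMIALS: `deg E_k ≤ 2k` and `[X^{2k}] E_k = (−1)^k/(2^k·k!)` (so `s(m, m−k) =
(−1)^k m^{2k}/(2^k k!) + O(m^{2k−1})`; e.g. `s(m, m−1) = −C(m,2)`, `s(m, m−2) = C(m,3)(3m−1)/4`). [cite: Stanley2012EC1, §1.3 Prop. 1.3.7 eq. (1.28); Exercise 1.43; lane lemma] -/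
theorem natDegree_stirlingPoly_le_and_coeff (k : ℕ) :
    (stirlingPoly k).natDegree ≤ 2 * k ∧ (stirlingPoly k).coeff (2 * k) = (-1) ^ k / (2 ^ k * (k.factorial : ℚ)) := by
  induction k with
  | zero => simp
  | succ k ih =>
    obtain ⟨hdeg, hc⟩ := ih
    have hcne : (stirlingPoly k).coeff (2 * k) ≠ 0 := by
      rw [hc]
      have : (k.factorial : ℚ) ≠ 0 := by exact_mod_cast k.factorial_ne_zero
      exact div_ne_zero (pow_ne_zero _ (by norm_num)) (by positivity)
    have hne : stirlingPoly k ≠ 0 := fun h => hcne (by rw [h, Polynomial.coeff_zero])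
    have hdeg' : (stirlingPoly k).natDegree = 2 * k := le_antisymm hdeg (Polynomial.le_natDegree_of_ne_zero hcne)
    have hXdeg : (Polynomial.X * stirlingPoly k).natDegree = 2 * k + 1 := by
      rw [Polynomial.natDegree_X_mul hne, hdeg']
    have hXlc : (Polynomial.X * stirlingPoly k).leadingCoeff = (-1) ^ k / (2 ^ k * (k.factorial : ℚ)) := by
      rw [Polynomial.leadingCoeff_mul, Polynomial.leadingCoeff_X, one_mul, Polynomial.leadingCoeff, hdeg', hc]
    refine ⟨?_, ?_⟩
    · rw [stirlingPoly_succ]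
      refine (Polynomial.natDegree_sub_le _ _).trans (max_le ?_ ((natDegree_sumPoly_le _).trans (by rw [hXdeg]; omega)))
      rw [Polynomial.natDegree_C]; exact Nat.zero_le _
    · rw [stirlingPoly_succ, Polynomial.coeff_sub, Polynomial.coeff_C, if_neg (by omega), zero_sub,
        show 2 * (k + 1) = (2 * k + 1) + 1 by ring, ← hXdeg, coeff_sumPoly_natDegree_succ, hXlc, hXdeg, Nat.factorial_succ]
      push_cast
      have hk : (k.factorial : ℚ) ≠ 0 := by exact_mod_cast k.factorial_ne_zero
      have h2 : (2 : ℚ) * k + 1 + 1 ≠ 0 := by positivity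
      field_simp
      ring

/-- `deg E_k = 2k` exactly. [cite: Stanley2012EC1, §1.3 Prop. 1.3.7 eq. (1.28); lane lemma] -/
theorem natDegree_stirlingPoly (k : ℕ) : (stirlingPoly k).natDegree = 2 * k := by
  obtain ⟨hdeg, hc⟩ := natDegree_stirlingPoly_le_and_coeff k
  refine le_antisymm hdeg (Polynomial.le_natDegree_of_ne_zero ?_)
  rw [hc]
  have : (k.factorial : ℚ) ≠ 0 := by exact_mod_cast k.factorial_ne_zero
  exact div_ne_zero (pow_ne_zero _ (by norm_num)) (by positivity)

/-- `lc E_k = (−1)^k/(2^k·k!)`. [cite: Stanley2012EC1, §1.3 Prop. 1.3.7 eq. (1.28); lane lemma] -/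
theorem leadingCoeff_stirlingPoly (k : ℕ) : (stirlingPoly k).leadingCoeff = (-1) ^ k / (2 ^ k * (k.factorial : ℚ)) := by
  rw [Polynomial.leadingCoeff, natDegree_stirlingPoly, (natDegree_stirlingPoly_le_and_coeff k).2]

/-- `E_k ≠ 0`. [cite: Stanley2012EC1, §1.3 Prop. 1.3.7 eq. (1.28); lane plumbing] -/
theorem stirlingPoly_ne_zero (k : ℕ) : stirlingPoly k ≠ 0 := by
  intro h
  have := leadingCoeff_stirlingPoly k
  rw [h, Polynomial.leadingCoeff_zero] at this
  have hk : (k.factorial : ℚ) ≠ 0 := by exact_mod_cast k.factorial_ne_zero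
  exact (div_ne_zero (pow_ne_zero _ (by norm_num)) (by positivity)) this.symm

/-- Uniqueness: a polynomial agreeing with `m ↦ [X^{m−k}] (X)_m` at every `m ≥ k` IS `E_k`. [cite: Stanley2012EC1, §1.3 Prop. 1.3.7 eq. (1.28); lane plumbing] -/
theorem eq_stirlingPoly_of_eval (k : ℕ) (Q : Polynomial ℚ) (hQ : ∀ m : ℕ, k ≤ m → (descPochhammer ℚ m).coeff (m - k) = Q.eval (m : ℚ)) :
    Q = stirlingPoly k := by
  apply Polynomial.eq_of_infinite_eval_eq
  apply Set.infinite_of_injective_forall_mem (f := fun i : ℕ => ((i + k : ℕ) : ℚ)) (fun a b h => by simpa using h)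
  intro i
  simp only [Set.mem_setOf_eq]
  rw [← hQ (i + k) (by omega), descPochhammer_coeff_sub_eq_eval_stirlingPoly k (i + k) (by omega)]

/-- `E₁ = −X(X−1)/2` (`s(m, m−1) = −C(m,2)`). [cite: Stanley2012EC1, §1.3 Exercise 1.43; lane lemma] -/
theorem stirlingPoly_one : stirlingPoly 1 = Polynomial.C (-1 / 2 : ℚ) * (Polynomial.X * (Polynomial.X - 1)) := by
  symm
  apply eq_stirlingPoly_of_eval
  intro m hm
  obtain ⟨u, rfl⟩ : ∃ u, m = u + 1 := ⟨m - 1, by omega⟩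
  rw [Nat.add_sub_cancel, descPochhammer_coeff_pred, Nat.cast_choose_two, Polynomial.eval_mul, Polynomial.eval_C, Polynomial.eval_mul,
    Polynomial.eval_sub, Polynomial.eval_X, Polynomial.eval_one]
  push_cast
  ring

/-! ### The explicit coefficient polynomial `S_j = A_j − B_j` of `[X^{n−j}] P_n = 2^n S_j(n)` -/

/-- `[X^k] (2X − 1)^m = (−1)^{m−k} 2^k C(m,k)` (`k ≤ m`). [cite: MadrasSlade1993, §1.2 (p. 10); lane plumbing] -/
private theorem fcan_coeff_twoX_sub_one_pow {m k : ℕ} (hk : k ≤ m) :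
    ((Polynomial.C (2 : ℚ) * Polynomial.X - 1) ^ m).coeff k = (-1 : ℚ) ^ (m - k) * 2 ^ k * (m.choose k : ℕ) := by
  have hfac : Polynomial.C (2 : ℚ) * Polynomial.X - 1 = Polynomial.C (2 : ℚ) * (Polynomial.X + Polynomial.C (-1/2 : ℚ)) := by
    rw [mul_add, ← map_mul]; norm_num
    rw [sub_eq_add_neg, ← map_one Polynomial.C, ← map_neg]
  rw [hfac, mul_pow, ← map_pow, Polynomial.coeff_C_mul, Polynomial.coeff_X_add_C_pow]
  obtain ⟨j, rfl⟩ : ∃ j, m = k + j := ⟨m - k, by omega⟩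
  rw [Nat.add_sub_cancel_left, pow_add]
  have : (-1 / 2 : ℚ) ^ j * (2 : ℚ) ^ j = (-1) ^ j := by rw [← mul_pow]; norm_num
  linear_combination ((2 : ℚ) ^ k * ((k + j).choose k : ℕ)) * this

/-- The MAIN PART `A_j = (−1)^j/(2^j·j!) · (X−1)(X−2)⋯(X−j)` of the `j`-th `1/d`-symbol (the memory-2 term `2X(2X−1)^{n−1}`: `[X^{n−j}] = 2^n A_j(n)`).
[cite: MadrasSlade1993, §1.2 (p. 10); lane tool notion] -/
def symbolMainPoly (j : ℕ) : Polynomial ℚ :=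
  Polynomial.C ((-1 : ℚ) ^ j / (2 ^ j * (j.factorial : ℚ))) * (descPochhammer ℚ j).comp (Polynomial.X - 1)

/-- The BAD-WORD CORRECTION `B_j = Σ_{i=2}^{j} R_i(X) · E_{j−i}(X − i)` of the `j`-th `1/d`-symbol (`R_i = symbolPoly i`, `E_k = stirlingPoly k`).
[cite: MadrasSlade1993, §1.1 eq. (1.1.8) p. 5; Definition 1.2.4; lane tool notion] -/
def symbolCorrPoly (j : ℕ) : Polynomial ℚ :=
  ∑ i ∈ Finset.Ico 2 (j + 1), symbolPoly i * (stirlingPoly (j - i)).comp (Polynomial.X - Polynomial.C (i : ℚ))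

/-- The COEFFICIENT POLYNOMIAL `S_j = A_j − B_j` (the explicit witness of ζ's `exists_polynomial_countPoly_coeff`).
[cite: MadrasSlade1993, §1.1 eq. (1.1.8) p. 5; lane tool notion] -/
def coeffPoly (j : ℕ) : Polynomial ℚ := symbolMainPoly j - symbolCorrPoly j

/-- ★★ THE `j`-th `1/d`-SYMBOL, EXPLICITLY: for every `j ≥ 2` and `n ≥ 2j − 1`, `[X^{n−j}] P_n = 2^n · S_j(n)` with `S_j = coeffPoly j`
(`P_n = countPoly n`, `c_n(ℤ^d) = P_n(d)`; ζ's `exists_polynomial_countPoly_coeff` with its witness named).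
[cite: MadrasSlade1993, §1.1 eq. (1.1.8) p. 5; §1.2 p. 10] [cite: ClisbyLiangSlade2007, §3.3 eqs. (29)/(31); lane theorem] -/
theorem countPoly_coeff_eq_pow_mul_eval_coeffPoly (j : ℕ) (hj : 2 ≤ j) (n : ℕ) (hn : 2 * j ≤ n + 1) :
    (countPoly n).coeff (n - j) = 2 ^ n * (coeffPoly j).eval (n : ℚ) := by
  classical
  have hnj : j + 1 ≤ n := by omega
  -- the head term `2X(2X−1)^{n−1}`
  have hA : (Polynomial.C (2 : ℚ) * ((Polynomial.C (2 : ℚ) * Polynomial.X - 1) ^ (n - 1) * Polynomial.X)).coeff (n - j) =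
      2 ^ n * (symbolMainPoly j).eval (n : ℚ) := by
    rw [Polynomial.coeff_C_mul, show n - j = (n - 1 - j) + 1 by omega, Polynomial.coeff_mul_X, fcan_coeff_twoX_sub_one_pow (by omega : n - 1 - j ≤ n - 1),
      Nat.choose_symm_of_eq_add (by omega : n - 1 = (n - 1 - j) + j), symbolMainPoly, Polynomial.eval_mul, Polynomial.eval_C,
      Polynomial.eval_comp, Polynomial.eval_sub, Polynomial.eval_X, Polynomial.eval_one]
    have hcast : ((n : ℚ) - 1) = ((n - 1 : ℕ) : ℚ) := by rw [Nat.cast_sub (by omega)]; simp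
    have hch : (((n - 1).choose j : ℕ) : ℚ) = (descPochhammer ℚ j).eval (((n - 1 : ℕ) : ℚ)) / (j.factorial : ℚ) :=
      Nat.cast_choose_eq_descPochhammer_div ℚ (n - 1) j
    have hpow : (-1 : ℚ) ^ (n - 1 - (n - 1 - j)) = (-1) ^ j := by rw [show n - 1 - (n - 1 - j) = j by omega]
    have hf : (j.factorial : ℚ) ≠ 0 := by exact_mod_cast j.factorial_ne_zero
    have h2 : (2 : ℚ) ^ n = 2 ^ (n - 1 - j) * 2 ^ j * 2 := by
      rw [← pow_add, ← pow_succ]; congr 1; omega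
    rw [hcast, hch, hpow, h2]
    field_simp
  -- the falling-factorial sum
  have hB : (∑ u ∈ Finset.range (n - 1), Polynomial.C ((badCount n u : ℚ)) * descPochhammer ℚ u).coeff (n - j) =
      2 ^ n * (symbolCorrPoly j).eval (n : ℚ) := by
    rw [Polynomial.finsetSum_coeff]
    have hsplit : Finset.range (n - 1) = Finset.range (n - j) ∪ Finset.Ico (n - j) (n - 1) := by
      rw [Finset.range_eq_Ico, Finset.range_eq_Ico, Finset.Ico_union_Ico_eq_Ico (Nat.zero_le _) (by omega)]
    rw [hsplit, Finset.sum_union (by rw [Finset.range_eq_Ico]; exact Finset.Ico_disjoint_Ico_consecutive _ _ _)]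
    rw [Finset.sum_eq_zero (fun u hu => by
      rw [Polynomial.coeff_C_mul, descPochhammer_coeff_of_lt (by have := Finset.mem_range.1 hu; omega), mul_zero]), zero_add]
    have himage : Finset.Ico (n - j) (n - 1) = (Finset.Ico 2 (j + 1)).image (fun i => n - i) := by
      ext u
      simp only [Finset.mem_Ico, Finset.mem_image]
      constructor
      · rintro ⟨h1, h2⟩; exact ⟨n - u, ⟨by omega, by omega⟩, by omega⟩
      · rintro ⟨i, ⟨h1, h2⟩, rfl⟩; exact ⟨by omega, by omega⟩
    rw [himage, Finset.sum_image (fun i hi i' hi' h => by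
      have := Finset.mem_Ico.1 hi; have := Finset.mem_Ico.1 hi'; omega)]
    rw [symbolCorrPoly, Polynomial.eval_finsetSum, Finset.mul_sum]
    refine Finset.sum_congr rfl fun i hi => ?_
    have hi2 := Finset.mem_Ico.1 hi
    rw [Polynomial.coeff_C_mul, show n - j = (n - i) - (j - i) by omega, descPochhammer_coeff_sub_eq_eval_stirlingPoly (j - i) (n - i) (by omega),
      badCount_eq_card_badSlice (by omega : i ≤ n), card_badSlice_eq_pow_mul_eval i n (by omega),
      Polynomial.eval_mul, Polynomial.eval_comp, Polynomial.eval_sub, Polynomial.eval_X, Polynomial.eval_C]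
    have hcast : ((n : ℚ) - (i : ℚ)) = ((n - i : ℕ) : ℚ) := by rw [Nat.cast_sub (by omega)]
    rw [hcast]
    ring
  rw [countPoly, Polynomial.coeff_sub, hA, hB, coeffPoly, Polynomial.eval_sub]
  ring

/-- So `S_j` IS ζ's polynomial: any `S` with `[X^{n−j}] P_n = 2^n S(n)` for all `n ≥ 2j − 1` equals `coeffPoly j`.
[cite: MadrasSlade1993, §1.1 eq. (1.1.8) p. 5; lane plumbing] -/
theorem eq_coeffPoly_of_forall (j : ℕ) (hj : 2 ≤ j) (S : Polynomial ℚ)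
    (hS : ∀ n : ℕ, 2 * j ≤ n + 1 → (countPoly n).coeff (n - j) = 2 ^ n * S.eval (n : ℚ)) : S = coeffPoly j := by
  apply Polynomial.eq_of_infinite_eval_eq
  apply Set.infinite_of_injective_forall_mem (f := fun i : ℕ => ((i + 2 * j : ℕ) : ℚ)) (fun a b h => by simpa using h)
  intro i
  simp only [Set.mem_setOf_eq]
  have h1 := hS (i + 2 * j) (by omega)
  have h2 := countPoly_coeff_eq_pow_mul_eval_coeffPoly j hj (i + 2 * j) (by omega)
  rw [h1] at h2
  exact mul_left_cancel₀ (pow_ne_zero _ two_ne_zero) h2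

/-! ### The main part: degree `j`, leading coefficient `(−1)^j/(2^j·j!)` -/

/-- `deg A_j = j`. [cite: MadrasSlade1993, §1.2 (p. 10); lane lemma] -/
theorem natDegree_symbolMainPoly (j : ℕ) : (symbolMainPoly j).natDegree = j := by
  have hc : ((-1 : ℚ) ^ j / (2 ^ j * (j.factorial : ℚ))) ≠ 0 := by
    have : (j.factorial : ℚ) ≠ 0 := by exact_mod_cast j.factorial_ne_zero
    exact div_ne_zero (pow_ne_zero _ (by norm_num)) (by positivity)
  have h1 : (Polynomial.X - 1 : Polynomial ℚ) = Polynomial.X - Polynomial.C 1 := by rw [map_one]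
  rw [symbolMainPoly, h1, Polynomial.natDegree_C_mul hc, Polynomial.natDegree_comp, descPochhammer_natDegree, Polynomial.natDegree_X_sub_C, mul_one]

/-- `lc A_j = (−1)^j/(2^j·j!)` (the MONIC face: `2^j j!·(−1)^j A_j` is monic of degree `j`). [cite: MadrasSlade1993, §1.2 (p. 10); lane lemma] -/
theorem leadingCoeff_symbolMainPoly (j : ℕ) : (symbolMainPoly j).leadingCoeff = (-1 : ℚ) ^ j / (2 ^ j * (j.factorial : ℚ)) := by
  have h1 : (Polynomial.X - 1 : Polynomial ℚ) = Polynomial.X - Polynomial.C 1 := by rw [map_one]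
  rw [symbolMainPoly, h1, Polynomial.leadingCoeff_mul, Polynomial.leadingCoeff_C,
    Polynomial.leadingCoeff_comp (by rw [Polynomial.natDegree_X_sub_C]; exact one_ne_zero), (monic_descPochhammer ℚ j).leadingCoeff,
    (Polynomial.monic_X_sub_C (1 : ℚ)).leadingCoeff, one_pow, one_mul, mul_one]

/-! ### ★★★ FIRST CANCELLATION: every summand of `B_j` has degree `2j − 3`, their top coefficients sum to `2^{−j}/(j−2)!·(1 − 1)^{j−2}` -/

/-- One summand `R_i · E_{j−i}(X − i)` (`2 ≤ i ≤ j`): degree exactly `(2i − 3) + 2(j − i) = 2j − 3`.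
[cite: MadrasSlade1993, §1.1 eq. (1.1.8) p. 5; Definition 1.2.4; lane lemma] -/
theorem natDegree_symbolCorrPoly_term {i j : ℕ} (hi : 2 ≤ i) (hij : i ≤ j) :
    (symbolPoly i * (stirlingPoly (j - i)).comp (Polynomial.X - Polynomial.C (i : ℚ))).natDegree = 2 * j - 3 := by
  have hR : symbolPoly i ≠ 0 := by
    intro h
    have := natDegree_symbolPoly i hi
    rw [h, Polynomial.natDegree_zero] at this
    omega
  have hEdeg : ((stirlingPoly (j - i)).comp (Polynomial.X - Polynomial.C (i : ℚ))).natDegree = 2 * (j - i) := by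
    rw [Polynomial.natDegree_comp, natDegree_stirlingPoly, Polynomial.natDegree_X_sub_C, mul_one]
  have hE : (stirlingPoly (j - i)).comp (Polynomial.X - Polynomial.C (i : ℚ)) ≠ 0 := by
    intro h
    have hlc := Polynomial.leadingCoeff_comp (p := stirlingPoly (j - i)) (q := Polynomial.X - Polynomial.C (i : ℚ))
      (by rw [Polynomial.natDegree_X_sub_C]; exact one_ne_zero)
    rw [h, Polynomial.leadingCoeff_zero, (Polynomial.monic_X_sub_C (i : ℚ)).leadingCoeff, one_pow, mul_one] at hlc
    exact stirlingPoly_ne_zero _ (Polynomial.leadingCoeff_eq_zero.1 hlc.symm)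
  rw [Polynomial.natDegree_mul hR hE, natDegree_symbolPoly i hi, hEdeg]
  omega

/-- Its top coefficient: `[X^{2j−3}] (R_i · E_{j−i}(X − i)) = 2^{−i}/(i−2)! · (−1)^{j−i}/(2^{j−i}(j−i)!)`.
[cite: MadrasSlade1993, §1.1 eq. (1.1.8) p. 5; Definition 1.2.4; lane lemma] -/
theorem coeff_symbolCorrPoly_term {i j : ℕ} (hi : 2 ≤ i) (hij : i ≤ j) :
    (symbolPoly i * (stirlingPoly (j - i)).comp (Polynomial.X - Polynomial.C (i : ℚ))).coeff (2 * j - 3) =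
      (1 / 2) ^ i / ((i - 2).factorial : ℚ) * ((-1) ^ (j - i) / (2 ^ (j - i) * ((j - i).factorial : ℚ))) := by
  have hEdeg : ((stirlingPoly (j - i)).comp (Polynomial.X - Polynomial.C (i : ℚ))).natDegree = 2 * (j - i) := by
    rw [Polynomial.natDegree_comp, natDegree_stirlingPoly, Polynomial.natDegree_X_sub_C, mul_one]
  have hElc : ((stirlingPoly (j - i)).comp (Polynomial.X - Polynomial.C (i : ℚ))).leadingCoeff = (-1) ^ (j - i) / (2 ^ (j - i) * ((j - i).factorial : ℚ)) := by
    rw [Polynomial.leadingCoeff_comp (by rw [Polynomial.natDegree_X_sub_C]; exact one_ne_zero), leadingCoeff_stirlingPoly,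
      (Polynomial.monic_X_sub_C (i : ℚ)).leadingCoeff, one_pow, mul_one]
  have hsum : 2 * j - 3 = (symbolPoly i).natDegree + ((stirlingPoly (j - i)).comp (Polynomial.X - Polynomial.C (i : ℚ))).natDegree := by
    rw [natDegree_symbolPoly i hi, hEdeg]; omega
  rw [hsum, Polynomial.coeff_mul_degree_add_degree, ← Polynomial.coeff_natDegree, natDegree_symbolPoly i hi, coeff_symbolPoly_two_mul_sub_three i hi, hElc]

/-- `deg B_j ≤ 2j − 3`. [cite: MadrasSlade1993, §1.1 eq. (1.1.8) p. 5; Definition 1.2.4; lane lemma] -/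
theorem natDegree_symbolCorrPoly_le (j : ℕ) : (symbolCorrPoly j).natDegree ≤ 2 * j - 3 := by
  unfold symbolCorrPoly
  refine Polynomial.natDegree_sum_le_of_forall_le _ _ fun i hi => ?_
  have hi2 := Finset.mem_Ico.1 hi
  exact (natDegree_symbolCorrPoly_term hi2.1 (by omega)).le

/-- The top coefficient of `B_j` is the binomial alternating sum: `[X^{2j−3}] B_j = 2^{−j}/(j−2)! · Σ_{m ≤ j−2} (−1)^m C(j−2, m)` (`j ≥ 2`).
[cite: MadrasSlade1993, §1.1 eq. (1.1.8) p. 5; Definition 1.2.4; lane lemma] -/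
theorem coeff_symbolCorrPoly_top_eq_sum (j : ℕ) (hj : 2 ≤ j) :
    (symbolCorrPoly j).coeff (2 * j - 3) =
      (1 / 2) ^ j / ((j - 2).factorial : ℚ) * ∑ m ∈ Finset.range (j - 2 + 1), ((-1 : ℚ) ^ m * ((j - 2).choose m : ℕ)) := by
  unfold symbolCorrPoly
  rw [Polynomial.finsetSum_coeff, Finset.mul_sum]
  -- reindex `i = j − m`
  have himage : Finset.Ico 2 (j + 1) = (Finset.range (j - 2 + 1)).image (fun m => j - m) := by
    ext i
    simp only [Finset.mem_Ico, Finset.mem_image, Finset.mem_range]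
    constructor
    · rintro ⟨h1, h2⟩; exact ⟨j - i, by omega, by omega⟩
    · rintro ⟨m, hm, rfl⟩; exact ⟨by omega, by omega⟩
  rw [himage, Finset.sum_image (fun m hm m' hm' h => by
    have := Finset.mem_range.1 hm; have := Finset.mem_range.1 hm'; omega)]
  refine Finset.sum_congr rfl fun m hm => ?_
  have hm' := Finset.mem_range.1 hm
  rw [coeff_symbolCorrPoly_term (by omega : 2 ≤ j - m) (by omega : j - m ≤ j), show j - (j - m) = m by omega]
  obtain ⟨k, rfl⟩ : ∃ k, j = k + 2 := ⟨j - 2, by omega⟩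
  have e1 : k + 2 - 2 = k := by omega
  have e2 : k + 2 - m - 2 = k - m := by omega
  rw [e1] at hm' ⊢
  rw [e2]
  have hkm : m ≤ k := by omega
  have hf1 : ((k - m).factorial : ℚ) ≠ 0 := by exact_mod_cast (k - m).factorial_ne_zero
  have hf2 : (m.factorial : ℚ) ≠ 0 := by exact_mod_cast m.factorial_ne_zero
  have hf3 : (k.factorial : ℚ) ≠ 0 := by exact_mod_cast k.factorial_ne_zero
  have hch : ((k.choose m : ℕ) : ℚ) = (k.factorial : ℚ) / ((m.factorial : ℚ) * ((k - m).factorial : ℚ)) := by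
    rw [Nat.choose_eq_factorial_div_factorial hkm, Nat.cast_div (Nat.factorial_mul_factorial_dvd_factorial hkm) (by positivity)]
    push_cast; ring
  have hpow : ((1 : ℚ) / 2) ^ (k + 2 - m) = (1 / 2) ^ (k + 2) * 2 ^ m := by
    have : ((1 : ℚ) / 2) ^ (k + 2) = (1 / 2) ^ (k + 2 - m) * (1 / 2) ^ m := by rw [← pow_add]; congr 1; omega
    have h22 : ((1 : ℚ) / 2) ^ m * 2 ^ m = 1 := by rw [← mul_pow]; norm_num
    rw [this, mul_assoc, h22, mul_one]
  rw [hch, hpow]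
  field_simp

/-- ★★★ FIRST CANCELLATION: for every `j ≥ 3` the `X^{2j−3}`-coefficient of the bad-word correction `B_j = Σ_{i=2}^{j} R_i(X) E_{j−i}(X−i)` VANISHES —
the top coefficients `2^{−i}/(i−2)! · (−1)^{j−i}/(2^{j−i}(j−i)!)` of the `j − 1` summands (each of degree exactly `2j − 3`: λ's `coeff_symbolPoly_two_mul_sub_three`
times the Stirling leading term) add up to `2^{−j}/(j−2)!·(1 − 1)^{j−2} = 0`. [cite: MadrasSlade1993, §1.1 eq. (1.1.8) p. 5; Definition 1.2.4]
[cite: ClisbyLiangSlade2007, §3.3 eqs. (29)/(31); lane theorem] -/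
theorem coeff_symbolCorrPoly_two_mul_sub_three_eq_zero (j : ℕ) (hj : 3 ≤ j) : (symbolCorrPoly j).coeff (2 * j - 3) = 0 := by
  rw [coeff_symbolCorrPoly_top_eq_sum j (by omega)]
  have h := add_pow (-1 : ℚ) 1 (j - 2)
  simp only [one_pow, mul_one] at h
  rw [← h, show (-1 : ℚ) + 1 = 0 by norm_num, zero_pow (by omega), mul_zero]

/-- For `j = 2` the correction is `B₂ = R₂` of degree `1 = 2j − 3` with top coefficient `1/4` (no cancellation: one summand).
[cite: MadrasSlade1993, §1.1 eq. (1.1.8) p. 5; lane lemma] -/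
theorem coeff_symbolCorrPoly_two : (symbolCorrPoly 2).coeff 1 = 1 / 4 := by
  rw [show 1 = 2 * 2 - 3 by norm_num, coeff_symbolCorrPoly_top_eq_sum 2 le_rfl]
  norm_num

/-- ★★★ Hence `deg B_j ≤ 2j − 4` for every `j ≥ 3`: the bad-word correction to the `j`-th `1/d`-symbol is ONE DEGREE SMALLER than each of its summands.
[cite: MadrasSlade1993, §1.1 eq. (1.1.8) p. 5; Definition 1.2.4] [cite: ClisbyLiangSlade2007, §3.3 eqs. (29)/(31); lane theorem] -/
theorem natDegree_symbolCorrPoly_le_sub_four (j : ℕ) (hj : 3 ≤ j) : (symbolCorrPoly j).natDegree ≤ 2 * j - 4 := by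
  have hle := natDegree_symbolCorrPoly_le j
  by_contra hlt
  have heq : (symbolCorrPoly j).natDegree = 2 * j - 3 := by omega
  have hne : symbolCorrPoly j ≠ 0 := by
    intro h; rw [h, Polynomial.natDegree_zero] at heq; omega
  have := Polynomial.leadingCoeff_ne_zero.2 hne
  rw [Polynomial.leadingCoeff, heq, coeff_symbolCorrPoly_two_mul_sub_three_eq_zero j hj] at this
  exact this rfl

/-! ### Consequences for the coefficient polynomial `S_j` -/

/-- ★★ `deg S_j ≤ max(j, 2j − 4)` for every `j ≥ 2` (vs. the a-priori `2j − 3` of η/λ: the first of the `j − 3` cancellations that the lane's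
STRUCTURE CONJECTURE «`deg P_j = j`» (FINDING-ZD-FOURTH-SYMBOL §8) predicts; sharp for `j ≤ 4`). [cite: MadrasSlade1993, §1.1 eq. (1.1.8) p. 5; Definition 1.2.4]
[cite: ClisbyLiangSlade2007, §3.3 eqs. (29)/(31); lane theorem] -/
theorem natDegree_coeffPoly_le (j : ℕ) (hj : 2 ≤ j) : (coeffPoly j).natDegree ≤ max j (2 * j - 4) := by
  rw [coeffPoly]
  refine (Polynomial.natDegree_sub_le _ _).trans (max_le ?_ ?_)
  · rw [natDegree_symbolMainPoly]; exact le_max_left _ _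
  · rcases (show j = 2 ∨ 3 ≤ j by omega) with rfl | h3
    · exact (natDegree_symbolCorrPoly_le 2).trans (by norm_num)
    · exact (natDegree_symbolCorrPoly_le_sub_four j h3).trans (le_max_right _ _)

/-- For `j ≥ 4` the `X^{2j−3}`-coefficient of `S_j` vanishes (both parts do). [cite: MadrasSlade1993, §1.1 eq. (1.1.8) p. 5; lane theorem] -/
theorem coeff_coeffPoly_two_mul_sub_three_eq_zero (j : ℕ) (hj : 4 ≤ j) : (coeffPoly j).coeff (2 * j - 3) = 0 := by
  rw [coeffPoly, Polynomial.coeff_sub, coeff_symbolCorrPoly_two_mul_sub_three_eq_zero j (by omega),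
    Polynomial.coeff_eq_zero_of_natDegree_lt (by rw [natDegree_symbolMainPoly]; omega), sub_zero]

/-- ★★ THE MONIC FACE FOR `j ≤ 3`: for `j ∈ {2, 3}` the coefficient polynomial has degree EXACTLY `j` and leading coefficient `(−1)^j/(2^j·j!)` — the
bad-word correction is subleading (`deg B₂ = 1 < 2`, `deg B₃ ≤ 2 < 3`), so `[d^{n−j}] c_n(ℤ^d) = 2^{n−j}(−1)^j n^j/j! + O(2^n n^{j−1})` (the tree's `n² − 5n + 8` and
`−(n³ − 12n² + 59n − 138)` laws of `SAWCountZdTopCoefficients`/`SAWCountZdThirdCoefficient` seen structurally). [cite: MadrasSlade1993, §1.1 eq. (1.1.8) p. 5; Definition 1.2.4]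
[cite: ClisbyLiangSlade2007, §3.3 eqs. (29)/(31); lane theorem] -/
theorem natDegree_coeffPoly_of_le_three (j : ℕ) (hj : 2 ≤ j) (hj3 : j ≤ 3) :
    (coeffPoly j).natDegree = j ∧ (coeffPoly j).leadingCoeff = (-1 : ℚ) ^ j / (2 ^ j * (j.factorial : ℚ)) := by
  have hB : (symbolCorrPoly j).natDegree < j := by
    rcases (show j = 2 ∨ j = 3 by omega) with rfl | rfl
    · exact lt_of_le_of_lt (natDegree_symbolCorrPoly_le 2) (by norm_num)
    · exact lt_of_le_of_lt (natDegree_symbolCorrPoly_le_sub_four 3 le_rfl) (by norm_num)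
  have hB' : (symbolCorrPoly j).degree < (symbolMainPoly j).degree := by
    rw [Polynomial.degree_eq_natDegree (p := symbolMainPoly j) (by
      intro h; have := natDegree_symbolMainPoly j; rw [h, Polynomial.natDegree_zero] at this; omega), natDegree_symbolMainPoly]
    exact lt_of_le_of_lt (Polynomial.degree_le_natDegree) (by exact_mod_cast hB)
  refine ⟨?_, ?_⟩
  · rw [coeffPoly, Polynomial.natDegree_sub_eq_left_of_natDegree_lt (by rw [natDegree_symbolMainPoly]; exact hB), natDegree_symbolMainPoly]
  · rw [coeffPoly, Polynomial.leadingCoeff_sub_of_degree_lt hB', leadingCoeff_symbolMainPoly]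

/-- ★★★ COEFFICIENT POLYNOMIALITY WITH THE FIRST CANCELLATION (ζ sharpened): for every `j ≥ 2` there is `S ∈ ℚ[X]` of degree `≤ max(j, 2j − 4)` with
`[X^{n−j}] P_n = 2^n S(n)` for all `n ≥ 2j − 1` — the `j`-th `1/d`-symbol of `c_n(ℤ^d)` is `2^n` times a polynomial in `n` of degree at most `max(j, 2j − 4)`.
[cite: MadrasSlade1993, §1.1 eq. (1.1.8) p. 5; §1.2 p. 10] [cite: ClisbyLiangSlade2007, §3.3 eqs. (29)/(31); lane theorem] -/
theorem exists_polynomial_countPoly_coeff_natDegree_le (j : ℕ) (hj : 2 ≤ j) :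
    ∃ S : Polynomial ℚ, S.natDegree ≤ max j (2 * j - 4) ∧ ∀ n : ℕ, 2 * j ≤ n + 1 → (countPoly n).coeff (n - j) = 2 ^ n * S.eval (n : ℚ) :=
  ⟨coeffPoly j, natDegree_coeffPoly_le j hj, fun n hn => countPoly_coeff_eq_pow_mul_eval_coeffPoly j hj n hn⟩

end WordTypes

end Literature.Probability.RandomPlanarGeometry.SAW.Zd
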